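import Literature.Computability.AlgebraicComplexity.DIP20MultiplicityObstructions
import HarnessLib

/-!
# Chow reciprocity (Hermite–Hadamard–Howe): the objects

Topic `Literature/Computability/AlgebraicComplexity` (cell `val-lit`, PROGRAMME #6 `chowReciprocity_holds`,
architect's definitions file; see `HOME/bip/NOTE-p7g5-chowReciprocity-discharge-sizing.md`). Definitions only —
the theorem files of the programme (`ChowHadamardHowePullback`, `ChowPolarization`, `ChowTransposeIdentity`,
`ChowReciprocalCertificate`) import this one.

CHOW RECIPROCITY (Hadamard 1897; Hermite reciprocity for `N = 2`; Landsberg, *Geometric Complexity Theory*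
(2017) Thm. 9.1.1.4 with Ex. 9.1.2.1): the multiplicity of the `GL_N`-type `χ` in degree `d` of the
coordinate ring of the Chow variety `Ch_n(k^N)` of products of `n` linear forms equals the multiplicity of
`χ` in degree `n` of the coordinate ring of `Ch_d(k^N)`. Mechanism: `k[Ch_n]_d ≅ im h_{d,n}` for the
Hermite–Hadamard–Howe map `h_{d,n} : Sym^d(Sym^n V) → Sym^n(Sym^d V)`, `F ↦ ((ℓ₁,…,ℓ_n) ↦ F(ℓ₁⋯ℓ_n))`
(Hadamard: `ker h_{d,n} = I_d(Ch_n)`), and `h_{n,d}` is the TRANSPOSE of `h_{d,n}` (Landsberg Def. 9.1.1.1: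
the FIRST index of `h_{d,n}` is the degree `d`).

Everything is built on the tree's generic product of `n` linear forms in `N` variables
`genericChowProduct N n = ∏_{l<n} Σ_i Y_{(l,i)} x_i` (`DIP20MultiplicityObstructions.lean` §H, index convention
(form, variable) = `Fin n × Fin N`; its bridge to `chowSet`/`formCoeff` is `aeval_genericChowMap` /
`eval_coeff_genericChowProduct` there; for `N = n`, `ChowPullback.genericProduct` is the same product in the
(variable, form) convention, i.e. `map (rename Prod.swap)` of it). This file defines:

* `ChowReciprocity.hadamardHowe N n : k[Sym^n k^N] →ₐ k[Mat_{n×N}]`, `F ↦ F(∏_l ℓ_l)` — the COMORPHISM OF THE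
  PRODUCT MAP `(k^N)^n → Ch_n(k^N)` (`= aeval fun e => coeff e.1 (genericChowProduct N n)`, given a name);
  its degree-`d` part is `h_{d,n}` followed by the inclusion `Sym^n(Sym^d V) ⊂ k[Mat_{n×N}]`;
* `ChowReciprocity.formSubst N n A` — substitution of each form's coefficient vector `a_l ↦ A a_l`
  (`(formSubst A p)(a) = p(l ↦ A (a l))`), through which `GL_N` acts (`A = g⁻¹` matches `coordRep`'s
  `(g·F)(v) = F(g⁻¹v)`);
* `ChowReciprocity.formPower N n d kk = (Σ_i Y_{(kk,i)} x_i)^n` and the POLARISATION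
  `ChowReciprocity.polarize N n d : k[Sym^n k^N] →ₗ k[Mat_{d×N}]`,
  `F ↦ coefficient of t₀⋯t_{d−1} in F(formCoeff_n (Σ_kk t_kk ℓ_kk^n))` — on forms of degree `d` the
  equivariant identification of `Sym^d(Sym^n V)` with the form-symmetric part of `⊗^d Sym^n V ⊂ k[Mat_{d×N}]`;
* `ChowReciprocity.apolarPairing` — the factorial-weighted monomial pairing `⟪X^a, X^b⟫ = δ_{ab} ∏ a_i!`
  (Bombieri/apolar), for which substitution by `A` is adjoint to substitution by `Aᵀ`.

The transpose identity to be proved (file `ChowTransposeIdentity`):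
`(n!)^d · d! · ⟪hadamardHowe N n F, polarize N d n G⟫ = (d!)^n · n! · ⟪polarize N n d F, hadamardHowe N d G⟫`
for `F` of degree `d` on `Sym^n` and `G` of degree `n` on `Sym^d` (both sides count the `N`-ary `d × n` arrays
with prescribed row and column contents — transpose the array). Honest framing: classical invariant theory
serving DIP 2020's toy separation `Ch_4^7`; typed ≠ endorsed; nothing here bears on `VP ≠ VNP`, NOT proved.

## References

* J. M. Landsberg, *Geometric Complexity Theory* (CUP 2017, doi:10.1017/9781108183192), §9.1.1
  (Def. 9.1.1.1, Thm. 9.1.1.4 Hadamard), Ex. 9.1.2.1 (`h_{d,n}ᵀ = h_{n,d}`), Thm. 9.1.2.5 (Hermite). [Landsberg2017]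
* J. Dörfler, C. Ikenmeyer, G. Panova, *On geometric complexity theory: multiplicity obstructions are
  stronger than occurrence obstructions*, SIAM J. Appl. Algebra Geom. 4 (2020), §2, §5. [DorflerIkenmeyerPanova2020]
-/

noncomputable section

open MvPolynomial

namespace Literature.Computability.AlgebraicComplexity

namespace ChowReciprocity

variable {k : Type} [Field k] (N n d : ℕ)

/-- **The comorphism of the product map `(k^N)^n → Ch_n(k^N)`** (Landsberg Def. 9.1.1.1: its degree-`d`
component is the Hermite–Hadamard–Howe map `h_{d,n}` followed by the inclusion
`Sym^n(Sym^d V) ⊂ k[Mat_{n×N}]`): the polynomial function `F` on `Sym^n k^N` goes to the polynomial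
`F(∏_l ℓ_l)` in the coefficients `Y_{(l,i)}` of `n` linear forms — the tree's
`aeval fun e => coeff e.1 (genericChowProduct N n)` (bridge to `chowSet`: `aeval_genericChowMap`), named.
[cite: Landsberg2017, §9.1.1 (Def. 9.1.1.1, Thm. 9.1.1.4)] -/
def hadamardHowe : MvPolynomial (DegIdx (Fin N) n) k →ₐ[k] MvPolynomial (Fin n × Fin N) k :=
  aeval fun e => coeff e.1 (genericChowProduct (k := k) N n)

/-- Substitution of each form's coefficient vector by a square matrix `A` on `k[Mat_{n×N}]`:
`Y_{(l,i)} ↦ Σ_{i'} A_{i i'} Y_{(l,i')}`, so that `(formSubst A p)(a) = p(l ↦ A (a l))`; `GL_N` acts through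
`A = g⁻¹` (matching `coordRep`). [cite: Landsberg2017, §9.1.1 (equivariance of h_{d,n})] -/
def formSubst (A : Matrix (Fin N) (Fin N) k) :
    MvPolynomial (Fin n × Fin N) k →ₐ[k] MvPolynomial (Fin n × Fin N) k :=
  aeval fun li => ∑ i' : Fin N, A li.2 i' • X (li.1, i')

/-- The `n`-th power `ℓ_kk^n = (Σ_i Y_{(kk,i)} x_i)^n` of the `kk`-th of `d` generic linear forms, whose
coefficient vector is the weighted Veronese point `(multinomial(e) · Y_{kk,·}^e)_e` of `Sym^n`.
[cite: Landsberg2017, Ex. 9.1.2.1 (h_{d,n} as inclusion followed by projection)] -/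
def formPower (kk : Fin d) : MvPolynomial (Fin N) (MvPolynomial (Fin d × Fin N) k) :=
  (∑ i : Fin N, C (X (kk, i)) * X i) ^ n

/-- **Polarisation `ι_{n→d}`**: `F ↦` the coefficient of `t₀ t₁ ⋯ t_{d−1}` in `F(formCoeff_n(Σ_kk t_kk ℓ_kk^n))`,
a `k`-linear map `k[Sym^n k^N] → k[Mat_{d×N}]`; on forms of degree `d` it is the `GL_N`-equivariant
identification of `Sym^d(Sym^n V)` with the form-symmetric tensors in `⊗^d Sym^n V`.
[cite: Landsberg2017, Ex. 9.1.2.1 (Sym^d(Sym^n V) ⊂ V^{⊗ nd})] -/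
def polarize : MvPolynomial (DegIdx (Fin N) n) k →ₗ[k] MvPolynomial (Fin d × Fin N) k :=
  ((MvPolynomial.lcoeff (MvPolynomial (Fin d × Fin N) k)
      (∑ kk : Fin d, Finsupp.single kk 1)).restrictScalars k) ∘ₗ
    (aeval (R := k) (S₁ := MvPolynomial (Fin d) (MvPolynomial (Fin d × Fin N) k))
      fun e : DegIdx (Fin N) n =>
        ∑ kk : Fin d, X kk * C (coeff e.1 (formPower N n d kk))).toLinearMap

variable {N n d}

/-- **The apolar (Bombieri) pairing** on a polynomial ring: `⟪p, q⟫ = Σ_a (∏_i a_i!) · p_a · q_a` — monomials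
are orthogonal with weight `∏ a_i!`; substitution by a matrix is adjoint to substitution by its transpose.
[cite: Landsberg2017, Ex. 9.1.2.1 (h_{d,n}ᵀ = h_{n,d})] -/
def apolarPairing {σ : Type*} (p q : MvPolynomial σ k) : k :=
  ∑ a ∈ p.support, ((a.prod fun _ m => (m.factorial : k)) * coeff a p) * coeff a q

end ChowReciprocity

end Literature.Computability.AlgebraicComplexity

end
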